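import Summits.KontsevichZagierPeriods.Statement
import Literature.StrongHypotheses.KontsevichZagierPeriods
import Literature.NumberTheory.Transcendental.KZKernelConjectureForms
import Literature.NumberTheory.Transcendental.KZVolumeConjectureProofs
import Literature.NumberTheory.Transcendental.KZLogCalculusProofs
import HarnessLib
import HarnessLib.Audit.TribunalTags

/-!
# Summit `KontsevichZagierPeriods` — bridges of the Strong-Hypothesis Library (D-0034)

Summit-side BRIDGE file for the registry `Literature/StrongHypotheses/KontsevichZagierPeriods.lean`: for
every `H` tagged there with `@[strong_hypothesis "KontsevichZagierPeriods.KontsevichZagierPeriods"]`, exactly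
ONE bridge tagged `@[summit_bridge "KontsevichZagierPeriods.KontsevichZagierPeriods"]`, concluding the ROOT
problem decl `_root_.KontsevichZagierPeriods` (`Summits/KontsevichZagierPeriods/KontsevichZagierPeriods/Statement.lean`;
`:= Literature.Periods.KZPeriodConjecture`, unfolded by `KontsevichZagierPeriods_iff`). Written with the
`_root_` prefix so that no namespace of the same name can capture the identifier.

* LANDED bridges (4, all `↔`, equivalent criteria): one-line compositions of theorems already proved in
  `Literature/NumberTheory/Transcendental/KZKernelConjectureForms.lean` (`kzPeriodConjecture'_iff_isRational`,
  `kzKernelConjecture_iff_isRational` — right-hand side verbatim the summit's body),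
  `KZVolumeConjectureProofs.lean` (`KZ.kzPeriodConjecture'_iff_volumeConjectureCompact_holds`, over the
  discharged Viu-Sos reduction) and `KZLogCalculusProofs.lean` (`KZlog.kzKernelConjecture_iff_kernelConjecture`,
  over `KZlog.Conservative_holds`), with `KontsevichZagierPeriods_iff`.
* PRINTED bridge (1): `GKZConjectureImpliesKontsevichZagierPeriods` (Cresson–Viu-Sos 2022, (1.3) and
  Thm. 2.1: "The GKZ-conjecture implies the KZ-conjecture"), a NAMED FACT (CONVENTIONS §4) to be discharged
  by a literature-prover as `theorem GKZConjectureImpliesKontsevichZagierPeriods_holds` in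
  `Summits/KontsevichZagierPeriods/KontsevichZagierPeriods/Theorems/StrongHypothesesGKZConjectureBridge.lean`
  (proof plan in its docstring).

No new mathematics is proved here; no `sorry`, no axiom.
-/

noncomputable section

namespace Summit.KontsevichZagierPeriods.StrongHypotheses

open Literature.NumberTheory.Transcendental
open Literature.StrongHypotheses.KontsevichZagierPeriods

/-! ## Equivalent criteria (landed) -/

/-- **All-semialgebraic-endpoint form ⇔ summit** (landed): `kzPeriodConjecture'_iff_isRational`
(`KZKernelConjectureForms`; KZ 2001 §1.1 remark "rational may be replaced by algebraic", in tree
`KZ.exists_isRational_equivalent_holds`) composed with the unfolding `KontsevichZagierPeriods_iff`.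
[cite: KontsevichZagier2001, §1.2 Conjecture 1] -/
@[summit_bridge "KontsevichZagierPeriods.KontsevichZagierPeriods"]
theorem kzPeriodConjecture'_iff_kontsevichZagierPeriods :
    KZPeriodConjecture' ↔ _root_.KontsevichZagierPeriods :=
  kzPeriodConjecture'_iff_isRational.trans KontsevichZagierPeriods_iff.symm

/-- **Kernel form ⇔ summit** (landed): `kzKernelConjecture_iff_isRational` (`KZKernelConjectureForms`;
KZ 2001 §1.2 Conjecture 1 in the injectivity shape of HMS 2017 Conj. 13.2.1) composed with
`KontsevichZagierPeriods_iff`. [cite: KontsevichZagier2001, §1.2 Conjecture 1] -/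
@[summit_bridge "KontsevichZagierPeriods.KontsevichZagierPeriods"]
theorem kzKernelConjecture_iff_kontsevichZagierPeriods :
    KZKernelConjecture ↔ _root_.KontsevichZagierPeriods :=
  kzKernelConjecture_iff_isRational.trans KontsevichZagierPeriods_iff.symm

/-- **Volume form ⇔ summit** (landed): the discharged named fact
`KZ.kzPeriodConjecture'_iff_volumeConjectureCompact_holds` (`KZVolumeConjectureProofs`, Cresson–Viu-Sos 2022
§1 p. 326 over Viu-Sos 2021 Thm. 1.1 = `KZ.semiCanonicalReduction_holds`) composed with
`kzPeriodConjecture'_iff_kontsevichZagierPeriods`. [cite: CressonViusos2022, §1 p. 326] -/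
@[summit_bridge "KontsevichZagierPeriods.KontsevichZagierPeriods"]
theorem volumeConjectureCompact_iff_kontsevichZagierPeriods :
    KZ.volumeConjectureCompact ↔ _root_.KontsevichZagierPeriods :=
  (show KZPeriodConjecture' ↔ KZ.volumeConjectureCompact from
      KZ.kzPeriodConjecture'_iff_volumeConjectureCompact_holds).symm.trans
    kzPeriodConjecture'_iff_kontsevichZagierPeriods

/-- **Logarithmic kernel form ⇔ summit** (landed): `KZlog.kzKernelConjecture_iff_kernelConjecture`
(`KZLogCalculusProofs`, over the proved conservativity `KZlog.Conservative_holds` of the nine-move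
logarithmic calculus over the KZ calculus) composed with `kzKernelConjecture_iff_kontsevichZagierPeriods`.
[folklore] -/
@[summit_bridge "KontsevichZagierPeriods.KontsevichZagierPeriods"]
theorem kzlogKernelConjecture_iff_kontsevichZagierPeriods :
    KZlog.KernelConjecture ↔ _root_.KontsevichZagierPeriods :=
  KZlog.kzKernelConjecture_iff_kernelConjecture.symm.trans kzKernelConjecture_iff_kontsevichZagierPeriods

/-! ## Strictly stronger hypothesis (printed bridge) -/

/-- **GKZ ⟹ KZ** — named fact: the geometric Kontsevich–Zagier conjecture of Cresson–Viu-Sos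
(`Literature.StrongHypotheses.KontsevichZagierPeriods.GKZConjecture`, injectivity of
`vol : K₀(CSA_{ℝalg}) → ℝ`) implies Conjecture 1 of Kontsevich–Zagier in its rules form (the summit).
Printed: "(1.3) GKZ ⟹ KZ" (p. 326) and "Theorem 2.1. The GKZ-conjecture implies the KZ-conjecture" (p. 331):
"From the previous discussions and the fact that any integral representation of a non-zero period can be
algorithmically reduced to the volume of a compact semi-algebraic set (up to sign)" [Viu-Sos 2021, Thm. 1.1]
together with "the geometric operations involved in the GKZ-conjecture … are compatible by definition with the
KZ-rules". PROOF PLAN for the discharge `theorem GKZConjectureImpliesKontsevichZagierPeriods_holds`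
(in `Summits/KontsevichZagierPeriods/KontsevichZagierPeriods/Theorems/StrongHypothesesGKZConjectureBridge.lean`):
(i) the additive map `Φ : GKZGroup →+ KZ.FormalRep`, `[K] ↦ KZ.of ⟨d, (K, 1)⟩` (integrand `1`, integrable
since `K` is compact); (ii) `Φ '' scissorsRel ⊆ KZ.domainAddRel`, `Φ '' volumePreservingRel ⊆
KZ.changeOfVariablesRel` (`IsSemialgebraicMapOn.mono` to `K`, `HasFDerivWithinAt` from `ContDiffOn` on the open
`U`, `|det| = 1`), `Φ '' flatteningRel ⊆ KZ.relations` (`n` Newton–Leibniz moves with primitive `t ↦ t` along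
the last coordinate, or the slab/product tools of `KZVolumeConjectureProofs` / `KZProduct`), hence
`Φ '' gkzRelations ⊆ KZ.relations` by `AddSubgroup.closure_le`; (iii) GKZ ⟹ `KZ.volumeConjectureCompact`:
for `d = 0` two integrand-`1` representations on the point are equivalent by integrand additivity alone; for
`d ≥ 1`, `[r] − Φ [r.domain] ∈ KZ.integrandAddRel`-generated (integrands agree on the domain), and
`gkzVol ([K₁] − [K₂]) = 0` gives `[K₁] − [K₂] ∈ gkzRelations`, mapped by `Φ` into `KZ.relations`;
(iv) conclude by `volumeConjectureCompact_iff_kontsevichZagierPeriods` (this file).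
[cite: CressonViusos2022, Thm. 2.1 (p. 331) and (1.3) (p. 326)] -/
@[summit_bridge "KontsevichZagierPeriods.KontsevichZagierPeriods"]
def GKZConjectureImpliesKontsevichZagierPeriods : Prop :=
  GKZConjecture → _root_.KontsevichZagierPeriods

end Summit.KontsevichZagierPeriods.StrongHypotheses
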